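import Summits.NavierStokesRegularity.NavierStokesRegularity.Theses.QuantisedSymmetry
import Summits.NavierStokesRegularity.NavierStokesRegularity.Theorems.QuantisedSymmetryPolyhedralDssProfileExistsOfCell
import HarnessLib

/-!
# Strategist census s10 — TYPED SPLITS for crux `PolyhedralDssProfileExists` (stmt-NavierStokesRegularity-1404)

Evidence file for `STRATEGY-CENSUS-s10.md` (independent census, family `s`). These are the best
typed splits / strengthenings the seat could produce; they are **not** registered lines: in each the
hard piece is exhibited and the census explains why it is the whole crux (or more). Definitions and
trivial compositions only — no `sorry`.

* §A  the cell reformulation `CellExists` (≡ crux, via the landed `stub_profileOfPolyhedralCell`).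
* §B  RECURRENCE split  `EquivariantTypeIAncientSingular ∧ RecurrentToPeriodic → crux`.
* §C  BORDERED NEWTON–KANTOROVICH split in log-time cell coordinates
      `NKCertificateExists ∧ BorderedNK ∧ FixedPointIsCell → CellExists → crux`
      (the computer-assisted-proof shape of Reiterer–Trubowitz arXiv:1203.3766 §0.1.2 and
      van den Berg–Breden–Lessard–van Veen arXiv:1902.00384 Thm 2.x, transplanted).
* §D  STRENGTHENING `NondegenerateCellExists` (a non-degenerate = certifiable orbit).
-/

noncomputable section

set_option linter.dupNamespace false
set_option linter.unusedVariables false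

namespace Summit.NavierStokesRegularity.NavierStokesRegularity.Cruxes.PolyhedralDssProfileExists.S10

open MeasureTheory Set Function Filter Topology
open Literature.Analysis.FluidPDE
open Summit.NavierStokesRegularity.NavierStokesRegularity.Theses

/-- ambient space `ℝ³`. -/
abbrev E3 := EuclideanSpace ℝ (Fin 3)
/-- its linear isometries. -/
abbrev Iso3 := EuclideanSpace ℝ (Fin 3) ≃ₗᵢ[ℝ] EuclideanSpace ℝ (Fin 3)

/-! ## §A  The polyhedral group clauses and the cell reformulation -/

/-- `G` is "polyhedral": finite, proper rotations, irreducible on `ℝ³` (forces `G ∈ {T, O, I}`). -/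
def IsPolyhedral (G : Subgroup Iso3) : Prop :=
  Finite G ∧ (∀ g ∈ G, LinearMap.det (g.toLinearEquiv : E3 →ₗ[ℝ] E3) = 1) ∧
  (∀ V : Submodule ℝ E3, (∀ g ∈ G, ∀ v ∈ V, g v ∈ V) → V = ⊥ ∨ V = ⊤)

/-- The `G`-cell predicate of `Theorems/…OfCell.lean` (`typeIDss_of_cell`): a field on the model
slab `[-1, -c⁻²] × ℝ³`, jointly continuous, bounded, weakly divergence free, Oseen-mild between all
pairs of model times, closing up under the zoom, `G`-equivariant slice by slice. -/
def IsGCell (G : Subgroup Iso3) (c : ℝ) (v : ℝ → E3 → E3) : Prop :=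
  ContinuousOn (Function.uncurry v) (Set.Icc (-1 : ℝ) (-(c ^ 2)⁻¹) ×ˢ Set.univ) ∧
  (∃ M : ℝ, ∀ t ∈ Set.Icc (-1 : ℝ) (-(c ^ 2)⁻¹), ∀ x, ‖v t x‖ ≤ M) ∧
  (∀ t ∈ Set.Icc (-1 : ℝ) (-(c ^ 2)⁻¹), IsWeaklyDivFree (v t)) ∧
  (∀ s t : ℝ, -1 ≤ s → s < t → t ≤ -(c ^ 2)⁻¹ → ∀ x,
    v t x = heatFlow (v s) (t - s) x - oseenDuhamel 1 s v v t x) ∧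
  (∀ x, v (-(c ^ 2)⁻¹) x = c • v (-1) (c • x)) ∧
  (∀ g ∈ G, ∀ t ∈ Set.Icc (-1 : ℝ) (-(c ^ 2)⁻¹), ∀ x, v t (g x) = g (v t x))

/-- **Cell form of the crux** (certified `↔` crux by the leads; here only `→` is re-derived). -/
def CellExists : Prop :=
  ∃ G : Subgroup Iso3, IsPolyhedral G ∧ ∃ c : ℝ, 1 < c ∧ ∃ v : ℝ → E3 → E3,
    IsGCell G c v ∧ MemLp (v (-1)) 4 volume ∧ ¬ (v (-1) =ᵐ[volume] 0)

/-- `CellExists → crux`, by the landed reduction `stub_profileOfPolyhedralCell`. -/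
theorem crux_of_cellExists (h : CellExists) : QuantisedSymmetry.PolyhedralDssProfileExists := by
  obtain ⟨G, ⟨hfin, hdet, hirr⟩, c, hc, v, hcell, hL4, hnt⟩ := h
  exact Theorems.PolyhedralDssProfileExists.PolyhedralCell.stub_profileOfPolyhedralCell
    ⟨G, hfin, hdet, hirr, c, hc, v, hcell, hL4, hnt⟩

/-! ## §B  RECURRENCE split (Decomposition attempt 2 of the census) -/

/-- **E1′ — a nontrivial `G`-equivariant Type-I ancient mild solution which is singular at the
space–time origin** (not locally bounded in any parabolic cylinder at `(0,0)`). Weaker than the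
crux in that no periodicity in logarithmic time is asked; it IS implied by the crux (stub N3
`stub_singularOrigin`), and it is the `G`-equivariant Type-I blow-up existence problem — the
negation of the route's kill switch `PolyhedralTypeILiouville` up to the bounded/unbounded gauge. -/
def EquivariantTypeIAncientSingular : Prop :=
  ∃ G : Subgroup Iso3, IsPolyhedral G ∧ ∃ u : ℝ → E3 → E3,
    IsAncientMildSolution 1 u ∧ (∀ t < 0, AEStronglyMeasurable (u t) volume) ∧
    (∃ C₀ : ℝ, HasTypeIDecay C₀ u) ∧ (∀ g ∈ G, ∀ t x, u t (g x) = g (u t x)) ∧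
    ∀ r : ℝ, 0 < r → ∀ M : ℝ, ∃ t ∈ Set.Ioo (-r ^ 2) 0, ∃ x : E3, ‖x‖ < r ∧ M < ‖u t x‖

/-- **E2 — recurrent-to-periodic**: from SOME singular equivariant Type-I ancient solution produce
an exactly DSS one. (Birkhoff recurrence in the compact zoom-orbit closure gives a uniformly
recurrent Type-I ancient solution for free; recurrent ⇒ periodic has no engine — this piece is the
crux again, and E1′ is itself open and summit-flavoured.) -/
def RecurrentToPeriodic : Prop :=
  EquivariantTypeIAncientSingular → QuantisedSymmetry.PolyhedralDssProfileExists

/-- the (trivial-seam) composition of the recurrence split. -/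
theorem crux_of_recurrence (h₁ : EquivariantTypeIAncientSingular) (h₂ : RecurrentToPeriodic) :
    QuantisedSymmetry.PolyhedralDssProfileExists := h₂ h₁

/-! ## §C  BORDERED NEWTON–KANTOROVICH split (Decomposition attempt 4 of the census)

Log-time coordinates on the model slab: `θ ∈ [0,1] ↦ t(θ) = -c^{-2θ} ∈ [-1, -c⁻²]`, so that the
domain `[0,1] × ℝ³` does not move when the period parameter `c` (an UNKNOWN of the bordered
problem, `S = 2 log c`) moves. Unknown `W(θ, x) = v(t(θ), x)`. The renormalised Picard map
`𝓣_c W (θ) = e^{(t(θ)+1)Δ} R_c(W 1) − B_{-1}(v, v)(t(θ))`, `R_c w (y) = c⁻¹ w(c⁻¹ y)` feeds the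
zoomed-back terminal slice in as initial datum, so `W = 𝓣_c W` encodes mildness AND the junction.
The zero set of `W ↦ W − 𝓣_c W` at a true cell contains the phase circle `μ ↦ v_μ`
(`v_μ(t,x) = μ v(μ²t, μx)`, `μ ∈ ℝ₊/c^ℤ`), so plain NK is never applicable; one borders with a
phase functional `ℓ` and the extra unknown `c` (van den Berg et al. 2021 §2.1 "phase condition").
-/

/-- zoom-back of a slice, `R_c w (y) = c⁻¹ • w (c⁻¹ • y)` (inverse of the junction zoom). -/
def zoomBack (c : ℝ) (w : E3 → E3) : E3 → E3 := fun y => c⁻¹ • w (c⁻¹ • y)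

/-- log-time parametrisation of the slab: `t(θ) = -(c^{2θ})⁻¹`, `t(0) = -1`, `t(1) = -c⁻²`. -/
def slabTime (c θ : ℝ) : ℝ := -((c ^ (2 * θ))⁻¹)

/-- its inverse `θ(t) = -log(-t) / (2 log c)`. -/
def slabParam (c t : ℝ) : ℝ := -Real.log (-t) / (2 * Real.log c)

/-- read a log-time field as a field on the physical slab. -/
def toSlab (c : ℝ) (W : ℝ → E3 → E3) : ℝ → E3 → E3 := fun t x => W (slabParam c t) x

/-- **the renormalised Picard map `𝓣_c`** on log-time fields. -/
def picard (c : ℝ) (W : ℝ → E3 → E3) : ℝ → E3 → E3 := fun θ x =>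
  heatFlow (zoomBack c (W 1)) (slabTime c θ + 1) x
    - oseenDuhamel 1 (-1) (toSlab c W) (toSlab c W) (slabTime c θ) x

/-- its (formal = exact, `𝓣_c` being linear + bilinear) derivative in `W` at `W`, applied to `H`. -/
def dPicard (c : ℝ) (W H : ℝ → E3 → E3) : ℝ → E3 → E3 := fun θ x =>
  heatFlow (zoomBack c (H 1)) (slabTime c θ + 1) x
    - oseenDuhamel 1 (-1) (toSlab c W) (toSlab c H) (slabTime c θ) x
    - oseenDuhamel 1 (-1) (toSlab c H) (toSlab c W) (slabTime c θ) x

/-- its derivative in the period parameter `c` (pointwise `deriv`). -/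
def dcPicard (c : ℝ) (W : ℝ → E3 → E3) : ℝ → E3 → E3 := fun θ x =>
  deriv (fun c' : ℝ => picard c' W θ x) c

/-- **the symmetry-reduced weighted space `Y_G`** (membership with weighted bound `M`): jointly
continuous on `[0,1] × ℝ³`, `‖W θ x‖ ≤ M/(1+‖x‖)` (Type-I-type weight; it puts every slice in
`L⁴(ℝ³)`), weakly divergence-free slices, `G`-equivariant slices. -/
def InSpace (G : Subgroup Iso3) (W : ℝ → E3 → E3) (M : ℝ) : Prop :=
  ContinuousOn (Function.uncurry W) (Set.Icc (0 : ℝ) 1 ×ˢ Set.univ) ∧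
  (∀ θ ∈ Set.Icc (0 : ℝ) 1, ∀ x, ‖W θ x‖ ≤ M / (1 + ‖x‖)) ∧
  (∀ θ ∈ Set.Icc (0 : ℝ) 1, IsWeaklyDivFree (W θ)) ∧
  (∀ g ∈ G, ∀ θ ∈ Set.Icc (0 : ℝ) 1, ∀ x, W θ (g x) = g (W θ x))

/-- weighted sup-distance `≤ r` on the slab. -/
def WDist (W W' : ℝ → E3 → E3) (r : ℝ) : Prop :=
  ∀ θ ∈ Set.Icc (0 : ℝ) 1, ∀ x, ‖W θ x - W' θ x‖ ≤ r / (1 + ‖x‖)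

/-- the bordered linearised operator at `(W₀, c₀)` applied to `(H, γ)`:
`(H, γ) ↦ H − D_W𝓣_{c₀}(W₀) H − γ ∂_c𝓣_{c₀}(W₀)`. -/
def borderedOp (c₀ : ℝ) (W₀ H : ℝ → E3 → E3) (γ : ℝ) : ℝ → E3 → E3 := fun θ x =>
  H θ x - dPicard c₀ W₀ H θ x - γ • dcPicard c₀ W₀ θ x

/-- **Sub₁ data — an NK CERTIFICATE at `(G, c₀, W₀)` with phase functional `ℓ` and margins
`(ε, K, L)`**: (i) `W₀ ∈ Y_G` with residual `‖W₀ − 𝓣_{c₀} W₀‖_Y ≤ ε`; (ii) the bordered linear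
problem `(borderedOp, ℓ) (H, γ) = (F, σ)` is uniquely solvable in `Y_G × ℝ` with bound `K`;
(iii) a Lipschitz bound `L` for the derivatives on the `2Kε`-ball; (iv) the Newton–Kantorovich
inequality `8K²Lε ≤ 1`, the ball stays in `c > 1`, and a nontriviality margin at `θ = 0`. -/
def NKCertificate (G : Subgroup Iso3) (c₀ : ℝ) (W₀ : ℝ → E3 → E3) (ℓ : (ℝ → E3 → E3) → ℝ)
    (ε K L : ℝ) : Prop :=
  (∃ M : ℝ, InSpace G W₀ M) ∧
  WDist W₀ (picard c₀ W₀) ε ∧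
  (∀ F : ℝ → E3 → E3, InSpace G F 1 → ∀ σ : ℝ, |σ| ≤ 1 →
    ∃ H : ℝ → E3 → E3, ∃ γ : ℝ, InSpace G H K ∧ |γ| ≤ K ∧ ℓ H = σ ∧
      ∀ θ ∈ Set.Icc (0 : ℝ) 1, ∀ x, borderedOp c₀ W₀ H γ θ x = F θ x) ∧
  (∀ (H : ℝ → E3 → E3) (γ : ℝ), (∃ M : ℝ, InSpace G H M) → ℓ H = 0 →
    (∀ θ ∈ Set.Icc (0 : ℝ) 1, ∀ x, borderedOp c₀ W₀ H γ θ x = 0) →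
      γ = 0 ∧ ∀ θ ∈ Set.Icc (0 : ℝ) 1, ∀ x, H θ x = 0) ∧
  (∀ (W : ℝ → E3 → E3) (c : ℝ) (H : ℝ → E3 → E3) (r : ℝ), WDist W W₀ (2 * K * ε) →
    |c - c₀| ≤ 2 * K * ε → 0 ≤ r → WDist H 0 r →
      WDist (dPicard c W H) (dPicard c₀ W₀ H) (L * (2 * K * ε) * r) ∧
      WDist (dcPicard c W) (dcPicard c₀ W₀) (L * (2 * K * ε))) ∧
  8 * K ^ 2 * L * ε ≤ 1 ∧ 2 * K * ε < c₀ - 1 ∧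
  (∃ x : E3, 4 * K * ε < ‖W₀ 0 x‖ * (1 + ‖x‖))

/-- **Sub₁ — an NK certificate EXISTS** (this is what a validated numerical candidate would be;
none exists: no approximate backward-DSS Navier–Stokes profile has ever been computed). -/
def NKCertificateExists : Prop :=
  ∃ G : Subgroup Iso3, IsPolyhedral G ∧ ∃ (c₀ : ℝ) (W₀ : ℝ → E3 → E3)
    (ℓ : (ℝ → E3 → E3) → ℝ) (ε K L : ℝ), 1 < c₀ ∧ 0 < ε ∧ 0 < K ∧ 0 ≤ L ∧
      NKCertificate G c₀ W₀ ℓ ε K L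

/-- **Sub₂ — bordered Newton–Kantorovich in `Y_G × ℝ`**: a certificate forces a true fixed point
`W = 𝓣_c W` within `2Kε` of `(W₀, c₀)`. (A theorem-shaped piece: the radii-polynomial NK of
van den Berg et al. 2021 Thm 2.x once `Y_G` is a Banach space on which `𝓣` is `C²`; the analytic
difficulty is that `D𝓣` is only quasi-compact in this norm — zoom contracts by `c⁻¹` — and the
Type-I weight is critical.) -/
def BorderedNK : Prop :=
  ∀ (G : Subgroup Iso3) (c₀ : ℝ) (W₀ : ℝ → E3 → E3) (ℓ : (ℝ → E3 → E3) → ℝ) (ε K L : ℝ),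
    IsPolyhedral G → 1 < c₀ → 0 < ε → 0 < K → 0 ≤ L → NKCertificate G c₀ W₀ ℓ ε K L →
      ∃ (c : ℝ) (W : ℝ → E3 → E3), |c - c₀| ≤ 2 * K * ε ∧ WDist W W₀ (2 * K * ε) ∧
        (∃ M : ℝ, InSpace G W M) ∧ ∀ θ ∈ Set.Icc (0 : ℝ) 1, ∀ x, W θ x = picard c W θ x

/-- **Sub₃ — undo the coordinates**: a fixed point of `𝓣_c` in `Y_G`, nonzero somewhere on the
initial slice, is a `G`-cell with `L⁴`, not-a.e.-zero datum (semigroup property of the mild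
formulation, `heatFlow_zero`, the weight `(1+‖x‖)⁻¹ ∈ L⁴(ℝ³)`, continuity). Routine. -/
def FixedPointIsCell : Prop :=
  ∀ (G : Subgroup Iso3) (c : ℝ) (W : ℝ → E3 → E3) (M : ℝ), 1 < c → InSpace G W M →
    (∀ θ ∈ Set.Icc (0 : ℝ) 1, ∀ x, W θ x = picard c W θ x) → (∃ x, W 0 x ≠ 0) →
      IsGCell G c (toSlab c W) ∧ MemLp (toSlab c W (-1)) 4 volume ∧
        ¬ (toSlab c W (-1) =ᵐ[volume] 0)

/-- nontriviality survives the Newton correction: the margin `4Kε < (1+‖x‖)‖W₀ 0 x‖` and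
`‖W − W₀‖_Y ≤ 2Kε` give `W 0 x ≠ 0`. -/
theorem nonzero_of_margin {W W₀ : ℝ → E3 → E3} {K ε : ℝ} {x : E3}
    (hW : WDist W W₀ (2 * K * ε)) (hx : 4 * K * ε < ‖W₀ 0 x‖ * (1 + ‖x‖))
    (hKε : 0 ≤ K * ε) : W 0 x ≠ 0 := by
  intro h0
  have h1 : ‖W 0 x - W₀ 0 x‖ ≤ 2 * K * ε / (1 + ‖x‖) := hW 0 ⟨le_refl 0, zero_le_one⟩ x
  rw [h0, zero_sub, norm_neg] at h1
  have hpos : 0 < 1 + ‖x‖ := by positivity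
  have h2 : ‖W₀ 0 x‖ * (1 + ‖x‖) ≤ 2 * K * ε := by
    rwa [le_div_iff₀ hpos] at h1
  nlinarith

/-- **the composition of the NK split** down to the cell form (hence, by `crux_of_cellExists`,
to the crux). Trivial seam — all content sits in Sub₁ (the candidate) and Sub₂ (the NK theorem in
a space where it is not yet known to make sense). -/
theorem cellExists_of_NK (h₁ : NKCertificateExists) (h₂ : BorderedNK) (h₃ : FixedPointIsCell) :
    CellExists := by
  obtain ⟨G, hG, c₀, W₀, ℓ, ε, K, L, hc₀, hε, hK, hL, hcert⟩ := h₁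
  obtain ⟨c, W, hcc, hWW, ⟨M, hWM⟩, hfix⟩ := h₂ G c₀ W₀ ℓ ε K L hG hc₀ hε hK hL hcert
  obtain ⟨_, _, _, _, _, _, hball, ⟨x, hx⟩⟩ := hcert
  have hc : 1 < c := by
    have := abs_le.1 hcc
    linarith [this.1]
  have hnz : ∃ x, W 0 x ≠ 0 :=
    ⟨x, nonzero_of_margin hWW hx (le_of_lt (mul_pos hK hε))⟩
  obtain ⟨hcell, hL4, hnt⟩ := h₃ G c W M hc hWM hfix hnz
  exact ⟨G, hG, c, hc, toSlab c W, hcell, hL4, hnt⟩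

/-- … and to the crux by name. -/
theorem crux_of_NK (h₁ : NKCertificateExists) (h₂ : BorderedNK) (h₃ : FixedPointIsCell) :
    QuantisedSymmetry.PolyhedralDssProfileExists :=
  crux_of_cellExists (cellExists_of_NK h₁ h₂ h₃)

/-! ## §D  STRENGTHENING: a non-degenerate (certifiable) orbit -/

/-- **S⁺ — a NON-DEGENERATE polyhedral cell exists**: a true fixed point `W = 𝓣_c W` in `Y_G`,
nonzero, at which the bordered linearisation is uniquely solvable with some bound `K` (the orbit
is isolated modulo phase and its period is locally rigid). The only strengthening with a
why-easier (it is exactly what a finite computation can certify, §C); strictly stronger than the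
crux; no candidate. -/
def NondegenerateCellExists : Prop :=
  ∃ G : Subgroup Iso3, IsPolyhedral G ∧ ∃ (c : ℝ) (W : ℝ → E3 → E3)
    (ℓ : (ℝ → E3 → E3) → ℝ) (K M : ℝ), 1 < c ∧ InSpace G W M ∧
      (∀ θ ∈ Set.Icc (0 : ℝ) 1, ∀ x, W θ x = picard c W θ x) ∧ (∃ x, W 0 x ≠ 0) ∧
      (∀ F : ℝ → E3 → E3, InSpace G F 1 → ∀ σ : ℝ, |σ| ≤ 1 →
        ∃ H : ℝ → E3 → E3, ∃ γ : ℝ, InSpace G H K ∧ |γ| ≤ K ∧ ℓ H = σ ∧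
          ∀ θ ∈ Set.Icc (0 : ℝ) 1, ∀ x, borderedOp c W H γ θ x = F θ x) ∧
      (∀ (H : ℝ → E3 → E3) (γ : ℝ), (∃ M' : ℝ, InSpace G H M') → ℓ H = 0 →
        (∀ θ ∈ Set.Icc (0 : ℝ) 1, ∀ x, borderedOp c W H γ θ x = 0) →
          γ = 0 ∧ ∀ θ ∈ Set.Icc (0 : ℝ) 1, ∀ x, H θ x = 0)

/-- `S⁺ → CellExists` given Sub₃ (forget the non-degeneracy). -/
theorem cellExists_of_nondegenerate (h : NondegenerateCellExists) (h₃ : FixedPointIsCell) :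
    CellExists := by
  obtain ⟨G, hG, c, W, ℓ, K, M, hc, hWM, hfix, hnz, -, -⟩ := h
  obtain ⟨hcell, hL4, hnt⟩ := h₃ G c W M hc hWM hfix hnz
  exact ⟨G, hG, c, hc, toSlab c W, hcell, hL4, hnt⟩

end Summit.NavierStokesRegularity.NavierStokesRegularity.Cruxes.PolyhedralDssProfileExists.S10

end
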